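import Summits.FinalStateConjecture.FinalStateConjecture.Theorems.BartnikGapSettlingGapExhaustionIKStepNormalisedData
import HarnessLib

/-!
# Crux `GapExhaustion` (stmt-FinalStateConjecture-10808), line `photon-shell-pseudoconvexity`:
# stub `stub_ikStepBoundAFar` (far chain F1b) — IK's smoothness constant for the normalised data
# at a FAR cylinder point is scale-free

Route `BartnikGapSettling`; helper (`--supports stmt-FinalStateConjecture-10808`) of line lead
c12 (wave 4, far chain F1b). At a far cylinder point `x` (`r(x) = c` large) the
Ionescu–Klainerman local extension theorem is applied to the data normalised at scale
`s = c · su`: `Gt y = s⁻² G(x + Ls y) ∘ (Ls × Ls)`, `ft y = c s⁻² (r(x + Ls y) − c)` with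
`Ls = s L`, `‖L‖ ≤ 6`. IK needs ONE constant `A ≥ Σ_{j=1}^6 ‖Dʲ Gt(y)‖ + Σ_{j=1}^4 ‖Dʲ ft(y)‖`
independent of `c`; this holds because the far-field bounds at the tube point `z = x + Ls y`
(`r(z) ≥ c/2`, `M ≤ c`) are scale-free: `‖Dʲ G(z)‖ ≤ (C_K + 1) M / r(z)^{j+1}` and
`‖Dʲ r(z)‖ ≤ C_K / r(z)^{j−1}`. The proof is that of the template `ikStep_bound_A` (absolute
constants, `s ≤ 1`) with the scale bookkeeping:

* `‖Dʲ Gt(y)‖ = s⁻² ‖Dʲ P(y)‖` for the pull-back metric `P y = G(x + Ls y) ∘ (Ls × Ls)`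
  (`affineCov_eq_pullMetric`, a metric datum on the open preimage of `W` by
  `affineCov_isCoordChangeOn`, `isMetricOn_pullMetric`), and
  `‖Dʲ P(y)‖ ≤ ‖Ls‖² ‖Ls‖ʲ ‖Dʲ G(z)‖ ≤ (6s)^{j+2} (C_K + 1) M / r(z)^{j+1}`
  (`affineBounds_norm_iteratedFDeriv_bilinearComp_affine_le`); with `1/r(z)^{j+1} ≤ (2/c)^{j+1}`,
  `s = c su`, `su ≤ 1`, `M ≤ c` this is `36 · 6ʲ · 2^{j+1} · suʲ · (C_K + 1) (M/c) ≤ 6⁸ 2⁷ (C_K + 1)`;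
* `‖Dʲ ft(y)‖ = c s⁻² ‖Dʲ (r ∘ (x + Ls ·))(y)‖ ≤ c s⁻² (6s)ʲ C_K (2/c)^{j−1}
  = 6ʲ 2^{j−1} su^{j−1} C_K / su ≤ 6⁴ · 8 · C_K / su` for `1 ≤ j ≤ 4`
  (`affineBounds_norm_iteratedFDeriv_comp_affine_le` on `{r > 0}`, `Kerr.contDiffAt_radius`).
-/

noncomputable section

-- instance search through the nested operator types `E4 →L[ℝ] E4 →L[ℝ] ℝ`
set_option maxSynthPendingDepth 3

-- D-0017: single-problem summit, `Summit.<S>.<S>.…` by design (cf. lakefile `weak.linter.dupNamespace`).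
set_option linter.dupNamespace false

namespace Summit.FinalStateConjecture.FinalStateConjecture.Theorems

open Set Function Metric
open Literature.Geometry.Lorentzian Literature.Geometry.Lorentzian.MetricCoord
open scoped Manifold ContDiff Topology ENNReal

/-! ### Scale bookkeeping -/

/-- The scale bookkeeping of the metric part: with `s = c · su`, `su ≤ 1`, `0 ≤ M ≤ c` and `j ≤ 6`,
`s⁻² (6s)² (6s)ʲ (C_K + 1) M / (c/2)^{j+1} = 36 · 6ʲ · 2^{j+1} (C_K + 1) suʲ (M/c) ≤ 6⁸ 2⁷ (C_K + 1)`.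
[folklore] -/
theorem ikStepFar_scale_Gt {c su s M CK : ℝ} (hc : 0 < c) (hsu : 0 < su) (hsu1 : su ≤ 1)
    (hs : s = c * su) (hM : 0 ≤ M) (hMc : M ≤ c) (hCK : 0 ≤ CK) {j : ℕ} (hj6 : j ≤ 6) :
    (s ^ 2)⁻¹ * ((6 * s) ^ 2 * (6 * s) ^ j * ((CK + 1) * M / (c / 2) ^ (j + 1))) ≤
      6 ^ 8 * 2 ^ 7 * (CK + 1) := by
  have hc0 : c ≠ 0 := hc.ne'
  have hsu0 : su ≠ 0 := hsu.ne'
  have h1 : (s ^ 2)⁻¹ * ((6 * s) ^ 2 * (6 * s) ^ j * ((CK + 1) * M / (c / 2) ^ (j + 1))) =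
      36 * 6 ^ j * 2 ^ (j + 1) * (CK + 1) * su ^ j * (M / c) := by
    subst hs
    rw [div_pow]
    field_simp
    ring
  have h2 : (6 : ℝ) ^ j ≤ 6 ^ 6 := pow_le_pow_right₀ (by norm_num) hj6
  have h3 : (2 : ℝ) ^ (j + 1) ≤ 2 ^ 7 := pow_le_pow_right₀ (by norm_num) (by omega)
  have h4 : su ^ j ≤ 1 := pow_le_one₀ hsu.le hsu1
  have h5 : M / c ≤ 1 := (div_le_one hc).2 hMc
  have h6 : 0 ≤ M / c := by positivity
  have hCK1 : 0 ≤ CK + 1 := by positivity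
  calc (s ^ 2)⁻¹ * ((6 * s) ^ 2 * (6 * s) ^ j * ((CK + 1) * M / (c / 2) ^ (j + 1)))
      = 36 * 6 ^ j * 2 ^ (j + 1) * (CK + 1) * su ^ j * (M / c) := h1
    _ ≤ 36 * 6 ^ 6 * 2 ^ 7 * (CK + 1) * 1 * 1 := by gcongr
    _ = 6 ^ 8 * 2 ^ 7 * (CK + 1) := by norm_num

/-- The scale bookkeeping of the defining-function part: with `s = c · su`, `su ≤ 1` and `k ≤ 3`
(`k = j − 1`), `c s⁻² (6s)^{k+1} C_K / (c/2)^k = 6^{k+1} 2^k C_K su^k / su ≤ 6⁴ · 8 · C_K / su`.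
[folklore] -/
theorem ikStepFar_scale_ft {c su s CK : ℝ} (hc : 0 < c) (hsu : 0 < su) (hsu1 : su ≤ 1)
    (hs : s = c * su) (hCK : 0 ≤ CK) {k : ℕ} (hk3 : k ≤ 3) :
    c * (s ^ 2)⁻¹ * ((6 * s) ^ (k + 1) * (CK / (c / 2) ^ k)) ≤ 6 ^ 4 * 8 * CK / su := by
  have hc0 : c ≠ 0 := hc.ne'
  have hsu0 : su ≠ 0 := hsu.ne'
  have h1 : c * (s ^ 2)⁻¹ * ((6 * s) ^ (k + 1) * (CK / (c / 2) ^ k)) =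
      6 ^ (k + 1) * 2 ^ k * CK * su ^ k / su := by
    subst hs
    rw [div_pow]
    field_simp
    ring
  have h2 : (6 : ℝ) ^ (k + 1) ≤ 6 ^ 4 := pow_le_pow_right₀ (by norm_num) (by omega)
  have h3 : (2 : ℝ) ^ k ≤ 8 := by
    calc (2 : ℝ) ^ k ≤ 2 ^ 3 := pow_le_pow_right₀ (by norm_num) hk3
      _ = 8 := by norm_num
  have h4 : su ^ k ≤ 1 := pow_le_one₀ hsu.le hsu1
  calc c * (s ^ 2)⁻¹ * ((6 * s) ^ (k + 1) * (CK / (c / 2) ^ k))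
      = 6 ^ (k + 1) * 2 ^ k * CK * su ^ k / su := h1
    _ ≤ 6 ^ 4 * 8 * CK * 1 / su := by gcongr
    _ = 6 ^ 4 * 8 * CK / su := by ring

/-! ### The far smoothness constant -/

section NormalisedDataFar

variable {G : E4 → E4 →L[ℝ] E4 →L[ℝ] ℝ} {W : Set E4} {a c s su M CK : ℝ} {x y : E4}
  {L Ls : E4 ≃L[ℝ] E4} {Gt : E4 → E4 →L[ℝ] E4 →L[ℝ] ℝ} {ft : E4 → ℝ}

/-- **Metric part.** `‖Dʲ Gt(y)‖ ≤ 6⁸ 2⁷ (C_K + 1)` for `j ≤ 6` at a point `y` whose image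
`z = x + Ls y ∈ W` has `r(z) ≥ c/2`, from `‖Dʲ G(z)‖ ≤ (C_K + 1) M / r(z)^{j+1}`, `M ≤ c`,
`Ls = s L`, `‖L‖ ≤ 6`, `s = c su`, `su ≤ 1`. [folklore] -/
theorem ikStepFar_bound_Gt (hGmet : IsMetricOn G W) (hc : 0 < c) (hsu : 0 < su) (hsu1 : su ≤ 1)
    (hs : s = c * su) (hM : 0 < M) (hMc : M ≤ c) (hCK : 0 ≤ CK)
    (hLs : (Ls : E4 →L[ℝ] E4) = s • (L : E4 →L[ℝ] E4)) (hL6 : ‖(L : E4 →L[ℝ] E4)‖ ≤ 6)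
    (hGt : ∀ y : E4, Gt y =
      (s ^ 2)⁻¹ • (G (x + Ls y)).bilinearComp (Ls : E4 →L[ℝ] E4) (Ls : E4 →L[ℝ] E4))
    (hyW : x + Ls y ∈ W) (hrc : c / 2 ≤ Kerr.radius a (x + Ls y)) {j : ℕ} (hj6 : j ≤ 6)
    (hKG : ‖iteratedFDeriv ℝ j G (x + Ls y)‖ ≤ (CK + 1) * M / Kerr.radius a (x + Ls y) ^ (j + 1)) :
    ‖iteratedFDeriv ℝ j Gt y‖ ≤ 6 ^ 8 * 2 ^ 7 * (CK + 1) := by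
  have hs0 : 0 < s := by rw [hs]; positivity
  have hnLs : ‖(Ls : E4 →L[ℝ] E4)‖ ≤ 6 * s := ikStep_norm_Ls hs0 hLs hL6
  have hnLs0 : 0 ≤ ‖(Ls : E4 →L[ℝ] E4)‖ := norm_nonneg _
  have hW : IsOpen W := hGmet.isOpen
  have hc2 : 0 < c / 2 := by positivity
  -- `Gt = s⁻² P` with `P` the pull-back metric
  set P : E4 → E4 →L[ℝ] E4 →L[ℝ] ℝ :=
    fun y => (G (x + Ls y)).bilinearComp (Ls : E4 →L[ℝ] E4) (Ls : E4 →L[ℝ] E4) with hPdef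
  have hGt' : Gt = fun y => (s ^ 2)⁻¹ • P y := funext hGt
  have hPeq : P = pullMetric G (fun y : E4 => x + Ls y) := affineCov_eq_pullMetric G Ls x
  have hPmet : IsMetricOn P ((fun y : E4 => x + Ls y) ⁻¹' W) := by
    rw [hPeq]; exact hGmet.isMetricOn_pullMetric (affineCov_isCoordChangeOn hGmet Ls x)
  rw [hGt', ikStep_iteratedFDeriv_const_smul hPmet.isOpen hPmet.contDiffOn _ j hyW, norm_smul,
    Real.norm_eq_abs, abs_of_pos (by positivity)]
  have hP := affineBounds_norm_iteratedFDeriv_bilinearComp_affine_le G (Ls : E4 →L[ℝ] E4)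
    (Ls : E4 →L[ℝ] E4) x hW hGmet.contDiffOn j hyW
  have h1 : ‖(Ls : E4 →L[ℝ] E4)‖ ^ 2 * ‖(Ls : E4 →L[ℝ] E4)‖ ^ j ≤ (6 * s) ^ 2 * (6 * s) ^ j := by
    gcongr
  -- `1 / r(z)^{j+1} ≤ (2/c)^{j+1}`
  have hKG' : ‖iteratedFDeriv ℝ j G (x + Ls y)‖ ≤ (CK + 1) * M / (c / 2) ^ (j + 1) :=
    hKG.trans (div_le_div_of_nonneg_left (by positivity) (pow_pos hc2 _)
      (pow_le_pow_left₀ hc2.le hrc _))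
  calc (s ^ 2)⁻¹ * ‖iteratedFDeriv ℝ j P y‖
      ≤ (s ^ 2)⁻¹ * (‖(Ls : E4 →L[ℝ] E4)‖ ^ 2 * ‖(Ls : E4 →L[ℝ] E4)‖ ^ j *
          ‖iteratedFDeriv ℝ j G (x + Ls y)‖) := by gcongr; exact hP
    _ ≤ (s ^ 2)⁻¹ * ((6 * s) ^ 2 * (6 * s) ^ j * ((CK + 1) * M / (c / 2) ^ (j + 1))) := by
        gcongr (s ^ 2)⁻¹ * ?_
        exact mul_le_mul h1 hKG' (norm_nonneg _) (by positivity)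
    _ ≤ 6 ^ 8 * 2 ^ 7 * (CK + 1) := ikStepFar_scale_Gt hc hsu hsu1 hs hM.le hMc hCK hj6

/-- **Defining-function part.** `‖Dʲ ft(y)‖ ≤ 6⁴ · 8 · C_K / su` for `1 ≤ j ≤ 4` at a point `y`
whose image `z = x + Ls y` has `r(z) ≥ c/2 > 0`, from `‖Dʲ r(z)‖ ≤ C_K / r(z)^{j−1}`, `Ls = s L`,
`‖L‖ ≤ 6`, `s = c su`, `su ≤ 1`. [folklore] -/
theorem ikStepFar_bound_ft (hc : 0 < c) (hsu : 0 < su) (hsu1 : su ≤ 1) (hs : s = c * su)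
    (hCK : 0 ≤ CK) (hLs : (Ls : E4 →L[ℝ] E4) = s • (L : E4 →L[ℝ] E4)) (hL6 : ‖(L : E4 →L[ℝ] E4)‖ ≤ 6)
    (hft : ∀ y : E4, ft y = c * (s ^ 2)⁻¹ * (Kerr.radius a (x + Ls y) - c))
    (hrc : c / 2 ≤ Kerr.radius a (x + Ls y)) {j : ℕ} (hj1 : 1 ≤ j) (hj4 : j ≤ 4)
    (hKr : ‖iteratedFDeriv ℝ j (Kerr.radius a) (x + Ls y)‖ ≤ CK / Kerr.radius a (x + Ls y) ^ (j - 1)) :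
    ‖iteratedFDeriv ℝ j ft y‖ ≤ 6 ^ 4 * 8 * CK / su := by
  have hs0 : 0 < s := by rw [hs]; positivity
  have hnLs : ‖(Ls : E4 →L[ℝ] E4)‖ ≤ 6 * s := ikStep_norm_Ls hs0 hLs hL6
  have hnLs0 : 0 ≤ ‖(Ls : E4 →L[ℝ] E4)‖ := norm_nonneg _
  have hc2 : 0 < c / 2 := by positivity
  have hr0 : 0 < Kerr.radius a (x + Ls y) := hc2.trans_le hrc
  -- `r` is smooth on the open set `{r > 0}`, which contains `z = x + Ls y`
  have hO : IsOpen {z : E4 | 0 < Kerr.radius a z} :=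
    isOpen_lt continuous_const (Kerr.continuous_radius a)
  have hrO : ContDiffOn ℝ ∞ (Kerr.radius a) {z : E4 | 0 < Kerr.radius a z} := fun z hz ↦
    (Kerr.contDiffAt_radius hz).contDiffWithinAt
  have haff : ContDiff ℝ ∞ (fun y : E4 => x + Ls y) :=
    contDiff_const.add (Ls : E4 →L[ℝ] E4).contDiff
  set g : E4 → ℝ := fun y => Kerr.radius a (x + Ls y) with hgdef
  have hO' : IsOpen ((fun y : E4 => x + Ls y) ⁻¹' {z : E4 | 0 < Kerr.radius a z}) :=
    hO.preimage haff.continuous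
  have hgO : ContDiffOn ℝ ∞ g ((fun y : E4 => x + Ls y) ⁻¹' {z : E4 | 0 < Kerr.radius a z}) := by
    have h := hrO.comp
      (haff.contDiffOn (s := (fun y : E4 => x + Ls y) ⁻¹' {z : E4 | 0 < Kerr.radius a z}))
      (fun z hz ↦ hz)
    simp only [Function.comp_def] at h
    exact h
  have hft' : ft = fun y => c * (s ^ 2)⁻¹ * (g y - c) := funext hft
  -- write `j = k + 1`, `k ≤ 3`
  obtain ⟨k, rfl⟩ : ∃ k : ℕ, j = k + 1 := ⟨j - 1, by omega⟩
  have hk3 : k ≤ 3 := by omega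
  have hKr' : ‖iteratedFDeriv ℝ (k + 1) (Kerr.radius a) (x + Ls y)‖ ≤ CK / (c / 2) ^ k := by
    rw [Nat.add_sub_cancel] at hKr
    exact hKr.trans (div_le_div_of_nonneg_left hCK (pow_pos hc2 _) (pow_le_pow_left₀ hc2.le hrc _))
  rw [hft', ikStep_iteratedFDeriv_const_mul_sub hO' hgO _ c hj1 hr0, norm_smul, Real.norm_eq_abs,
    abs_of_pos (by positivity)]
  have hsc := affineBounds_norm_iteratedFDeriv_comp_affine_le (Kerr.radius a) (Ls : E4 →L[ℝ] E4) x
    hO hrO (k + 1) hr0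
  have h1 : ‖(Ls : E4 →L[ℝ] E4)‖ ^ (k + 1) ≤ (6 * s) ^ (k + 1) := by gcongr
  calc c * (s ^ 2)⁻¹ * ‖iteratedFDeriv ℝ (k + 1) g y‖
      ≤ c * (s ^ 2)⁻¹ * (‖(Ls : E4 →L[ℝ] E4)‖ ^ (k + 1) *
          ‖iteratedFDeriv ℝ (k + 1) (Kerr.radius a) (x + Ls y)‖) := by
        gcongr; exact hsc
    _ ≤ c * (s ^ 2)⁻¹ * ((6 * s) ^ (k + 1) * (CK / (c / 2) ^ k)) := by
        gcongr c * (s ^ 2)⁻¹ * ?_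
        exact mul_le_mul h1 hKr' (norm_nonneg _) (by positivity)
    _ ≤ 6 ^ 4 * 8 * CK / su := ikStepFar_scale_ft hc hsu hsu1 hs hCK hk3

end NormalisedDataFar

/-- **IK's smoothness constant at a far cylinder point is scale-free** (registered stub
`stub_ikStepBoundAFar`, far chain F1b). For the data normalised at scale `s = c · su` at a far
cylinder point `x` — `Gt y = s⁻² G(x + Ls y) ∘ (Ls × Ls)`, `ft y = c s⁻² (r(x + Ls y) − c)`,
`Ls = s L`, `‖L‖ ≤ 6` — and a point `y` with `z = x + Ls y ∈ W`, `r(z) ≥ c/2`, the scale-free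
far-field bounds `‖Dʲ G(z)‖ ≤ (C_K + 1) M / r(z)^{j+1}` (`j ≤ 6`), `‖Dʲ r(z)‖ ≤ C_K / r(z)^{j−1}`
(`j ≤ 4`) and `M ≤ c` give
`Σ_{j=1}^6 ‖Dʲ Gt(y)‖ + Σ_{j=1}^4 ‖Dʲ ft(y)‖ ≤ 6 · 6⁸ 2⁷ (C_K + 1) + 4 · 6⁴ · 8 · C_K / su`,
a constant independent of `c`. [folklore] -/
theorem stub_ikStepBoundAFar : ∀ (G : E4 → E4 →L[ℝ] E4 →L[ℝ] ℝ) (W : Set E4) (a c s su M CK : ℝ) (x y : E4) (L Ls : E4 ≃L[ℝ] E4) (Gt : E4 → E4 →L[ℝ] E4 →L[ℝ] ℝ) (ft : E4 → ℝ), IsMetricOn G W → 0 < c → 0 < su → su ≤ 1 → s = c * su → 0 < M → M ≤ c → 0 ≤ CK → (Ls : E4 →L[ℝ] E4) = s • (L : E4 →L[ℝ] E4) → ‖(L : E4 →L[ℝ] E4)‖ ≤ 6 → (∀ y : E4, Gt y = (s ^ 2)⁻¹ • (G (x + Ls y)).bilinearComp (Ls : E4 →L[ℝ] E4) (Ls :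 E4 →L[ℝ] E4)) → (∀ y : E4, ft y = c * (s ^ 2)⁻¹ * (Kerr.radius a (x + Ls y) - c)) → x + Ls y ∈ W → c / 2 ≤ Kerr.radius a (x + Ls y) → ContDiffAt ℝ ∞ (Kerr.radius a) (x + Ls y) → (∀ j : ℕ, 1 ≤ j → j ≤ 6 → ‖iteratedFDeriv ℝ j G (x + Ls y)‖ ≤ (CK + 1) * M / Kerr.radius a (x + Ls y) ^ (j + 1)) → (∀ j : ℕ, 1 ≤ j → j ≤ 4 → ‖iteratedFDeriv ℝ j (Kerr.radius a) (x + Ls y)‖ ≤ CK / Kerr.radius a (x + Ls y) ^ (j - 1)) → (∑ j ∈ Finset.Icc 1 6, ‖iteratedFDeriv ℝ j Gt y‖) + (∑ j ∈ Finset.Icc 1 4, ‖iteratedFDeriv ℝ j ft y‖) ≤ 6 * (6 ^ 8 * 2 ^ 7 * (CK + 1)) + 4 * (6 ^ 4 * 8 * CK) / su := by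
  intro G W a c s su M CK x y L Ls Gt ft hGmet hc hsu hsu1 hs hM hMc hCK hLs hL6 hGt hft hyW hrc _hrC
    hKG hKr
  have hsumG : ∑ j ∈ Finset.Icc 1 6, ‖iteratedFDeriv ℝ j Gt y‖ ≤ 6 * (6 ^ 8 * 2 ^ 7 * (CK + 1)) := by
    calc ∑ j ∈ Finset.Icc 1 6, ‖iteratedFDeriv ℝ j Gt y‖
        ≤ ∑ j ∈ Finset.Icc 1 6, (6 : ℝ) ^ 8 * 2 ^ 7 * (CK + 1) :=
          Finset.sum_le_sum fun j hj ↦ ikStepFar_bound_Gt hGmet hc hsu hsu1 hs hM hMc hCK hLs hL6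
            hGt hyW hrc (Finset.mem_Icc.1 hj).2
            (hKG j (Finset.mem_Icc.1 hj).1 (Finset.mem_Icc.1 hj).2)
      _ = 6 * (6 ^ 8 * 2 ^ 7 * (CK + 1)) := by
          rw [Finset.sum_const, Nat.card_Icc, nsmul_eq_mul]; norm_num
  have hsumf : ∑ j ∈ Finset.Icc 1 4, ‖iteratedFDeriv ℝ j ft y‖ ≤ 4 * (6 ^ 4 * 8 * CK) / su := by
    calc ∑ j ∈ Finset.Icc 1 4, ‖iteratedFDeriv ℝ j ft y‖
        ≤ ∑ j ∈ Finset.Icc 1 4, (6 : ℝ) ^ 4 * 8 * CK / su :=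
          Finset.sum_le_sum fun j hj ↦ ikStepFar_bound_ft hc hsu hsu1 hs hCK hLs hL6 hft hrc
            (Finset.mem_Icc.1 hj).1 (Finset.mem_Icc.1 hj).2
            (hKr j (Finset.mem_Icc.1 hj).1 (Finset.mem_Icc.1 hj).2)
      _ = 4 * (6 ^ 4 * 8 * CK) / su := by
          rw [Finset.sum_const, Nat.card_Icc, nsmul_eq_mul]; norm_num; ring
  exact add_le_add hsumG hsumf

end Summit.FinalStateConjecture.FinalStateConjecture.Theorems

end
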